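import Summits.BirchSwinnertonDyer.BirchSwinnertonDyer.Theorems.ByReductionTypeAtTwoAdditiveKatoTransportPrintExactAnyImageTorsion
import Summits.BirchSwinnertonDyer.BirchSwinnertonDyer.Theorems.ByReductionTypeAtTwoAdditiveKatoTransportQuadraticLayerNegTwo
import Summits.BirchSwinnertonDyer.BirchSwinnertonDyer.Theorems.ByReductionTypeAtTwoAdditiveKatoTransportQuadraticLayerModel
import Summits.BirchSwinnertonDyer.BirchSwinnertonDyer.Theorems.ByReductionTypeAtTwoAdditiveKatoTransportPrintExactAnyImageMemberDecomposition
import Summits.BirchSwinnertonDyer.BirchSwinnertonDyer.Theorems.ByReductionTypeAtTwoAdditiveKatoTransportIsogenyDoors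
import HarnessLib

/-!
# Route ByReductionTypeAtTwo, crux C4″ `AdditivePotMultOverKAtTwo` (stmt-BirchSwinnertonDyer-22618; parent
# `AdditiveRankZeroAtTwo` 19098) — R17, part 3: the four split-twist block doors `ℓ_𝔮(X(W₁/ℚ_∞)) ≤ ℓ_𝔮(Λ/(L̃))` at EVERY
# height-one `𝔮 ∌ 2` (blocks (−1)/(−2), at `W` and at every `ℚ`-isogenous member `W₁`, key `γ` and key `γ⁻¹`, ANY image of
# `ρ̄_{W,2}`, functional equation in the kernel) keyed by {`Kato2004.thm12_4`, Greenberg Thm. 1.14 ×2, Greenberg Thm. 1.5} (PRINT,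
# BY NAME) + the ONE image-free odd-branch input + the model identification `ΘS` — `hdec`, `hXι`, `hirr`, `hD₀`, `hD₀′` and the
# finiteness instances ALL DISCHARGED (theorems only)

Cell `bsd-2adic`, seat `bsd-2adic-k4-w3` GEN 5 (explicit unit of director-bsd g16 (309)(7)). Composition of: GEN 4's
decomposition doors `AddKatoTwo.lengthAt_selmerDual_le_of_oddBranchInputs{,NegTwo}PrintExactAnyImage_of_decomposition_fe`
(p701753) and their lattice-free member transport (`lengthAt_selmerDual_eq_of_isIsogenous`, p701368); t42 GEN 23's
`AddKatoTwoQuadLayer.hdec_of_model` / `isTorsion_model_iff` (p700277; (−1)-block, `θ = √−1`) and this seat's (−2)-twins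
`hdec_of_model_negTwo` / `isTorsion_model_negTwo` (`…QuadraticLayerNegTwo`, `θ = √−2`); this seat's torsion theorems
(`…PrintExactAnyImageTorsion`): `X(W/ℚ_∞)` torsion from the ONE input, `X(W′/ℚ_∞)` torsion from Greenberg's Thm. 1.5; and the
tree's finiteness theorem `SelmerDualData.module_finite_holds` (Greenberg §1 p. 60, PROVED). Net effect on the board word of
the four split-twist blocks: at the Iwasawa level («Kato's divisibility at every height-one `𝔮 ∌ 2`, exceptional prime
included») the binders are now EXACTLY {PRINT ×4 by name, ONE typed input, the model identification `ΘS` over `ℚ(√−1)` resp.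
`ℚ(√−2)` (t42 GEN 24's lane: `…AdditiveSelmerBaseChangeModelIso`)} — no reading.

* §1 (−1)-block: `lengthAt_selmerDual_le_of_oddBranchInputsPrintExactAnyImage_fe_of_model` (key `γ`),
  `…Contra…_of_model` (key `γ⁻¹`), `…_of_model_of_isIsogenous` (every `W₁ ∼_ℚ W`: Kato's member `W_K` of the reducible block).
* §2 (−2)-block: the same three, keyed by the ONE `(−1)` input through R15
  (`AddKatoTwoGammaTwist.katoOddBranchInputsNegTwoPrintExactAnyImage_of_negOne`) and the model over `ℚ(√−2)`.

HONEST FRAMING (D-0036 / D-0054): theorems only — no definition, no named fact, no instance, no `sorry`; route-independent;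
CONDITIONAL on `Kato2004.thm12_4`, `Greenberg1999_thm114_charIdeal_iota_invariant`,
`Greenberg1999.thm114_charIdeal_iota_invariant_splitMult_baseChange`, `Greenberg1999.thm15_isTorsion_multiplicative_rat` (PRINT,
hypotheses BY NAME), on the typed input `KatoOddBranchInputsAtTwoNegOneSplitTwistPrintExactAnyImage` (conjecture-grade at `2`)
and on the displayed model identification `ΘS`; types-the-object-of (binder discharge); closes none; nothing booked; BSD is
not proved by any of this. PARTITION: X5@2 additive potentially-multiplicative block, the four split-twist sub-blocks × `p = 2`.

References: [Kato2004Asterisque] Thm. 12.4 (p. 221), Thm. 12.5 (3) with (12.5.1) (p. 222), Thm. 17.4 (1) (p. 273), §17.13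
(pp. 279–280); [GreenbergLNM1716] §1 (p. 60), Thm. 1.5 (p. 61), Thm. 1.14 (p. 68), §4 (p. 107); [Greenberg1989] pp. 101–102;
[GreenbergVatsal2000] §2 (p. 28); [DokchitserDokchitserAnnals2010] Lemma 4.14; [MazurTateTeitelbaum1986Invent] §I.17; memos
`run/shared/lean/pub/bsd-2adic/k4w3/gen4/VERDICT-22618-k4w3-GEN4.md`, `run/shared/lean/pub/bsd-2adic/t42/DESIGN-T42-ADDENDUM-27.md`.
-/

set_option autoImplicit false
-- the summit's namespace `Summit.BirchSwinnertonDyer.BirchSwinnertonDyer` (Sub = Summit) trips `dupNamespace`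
set_option linter.dupNamespace false

noncomputable section

open scoped Classical MatrixGroups ModularForm NumberField

open Field CongruenceSubgroup WeierstrassCurve IsDedekindDomain Literature.NumberTheory.EllipticCurves
  Literature.NumberTheory.EllipticCurves.ModularForms Literature.NumberTheory.EllipticCurves.IwasawaAlgebra
  Literature.NumberTheory.EllipticCurves.Module Literature.NumberTheory.EllipticCurves.QuadraticLayer
  Literature.NumberTheory.EllipticCurves.Greenberg1999 Literature.NumberTheory.GaloisRepresentations
  Summit.BirchSwinnertonDyer.BirchSwinnertonDyer.Theorems

namespace Summit.BirchSwinnertonDyer.BirchSwinnertonDyer.Theorems.AddKatoTwo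

/-! ## §0 A `ℚ`-model of the twist inherits the twist's reduction type -/

/-- **`W′ ≅_ℚ W^{(d)}` is split multiplicative at `p` when `W^{(d)}` is**: from `V • W = W′^{(d)}` (`d ≠ 0`),
`(C₂·C₁) • W′ = (u, d r, 0, 0) • W^{(d)}` (`exists_variableChange_quadraticTwist_one`, `…_mul_sq`, `quadraticTwist_smul`,
`quadraticTwist_quadraticTwist`), and split multiplicative reduction at `p` is a `ℚ`-isomorphism invariant
(`hasSplitMultiplicativeReductionAtPrime_smul_iff`). Discharges the binder `hmult′` of the lane's doors.
[cite: SilvermanAEC2009, VII.5 Prop. 5.1 (b), X.5 Cor. 5.4] -/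
theorem hasSplitMultiplicativeReductionAtPrime_twistModel (W W' : WeierstrassCurve ℚ) [W.IsElliptic] [W'.IsElliptic]
    {V : VariableChange ℚ} {d : ℚ} (hd : d ≠ 0) (hV : V • W = W'.quadraticTwist d) (p : ℕ) [Fact p.Prime]
    (hsp : (W.quadraticTwist d).HasSplitMultiplicativeReductionAtPrime p) : W'.HasSplitMultiplicativeReductionAtPrime p := by
  haveI : (W.quadraticTwist d).IsElliptic := W.isElliptic_quadraticTwist hd
  obtain ⟨C₁, hC₁⟩ := W'.exists_variableChange_quadraticTwist_one
  obtain ⟨C₂, hC₂⟩ := W'.exists_variableChange_quadraticTwist_mul_sq 1 d hd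
  have htw : (C₂ * C₁) • W' = (⟨V.u, d * V.r, 0, 0⟩ : VariableChange ℚ) • W.quadraticTwist d := by
    rw [mul_smul, hC₁, hC₂, ← quadraticTwist_smul, hV, quadraticTwist_quadraticTwist]
    ring_nf
  rw [← hasSplitMultiplicativeReductionAtPrime_smul_iff W' (C₂ * C₁) p, htw, hasSplitMultiplicativeReductionAtPrime_smul_iff]
  exact hsp

/-! ## §1 The (−1)-block doors modulo the model over `ℚ(√−1)` -/

section NegOne

variable (W : WeierstrassCurve ℚ) [W.IsElliptic] [W.IsGloballyMinimal] [ContinuousSMul ℤ_[2] (W.tateModule 2)]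
  (W' : WeierstrassCurve ℚ) [W'.IsElliptic] [W'.IsGloballyMinimal] {V : VariableChange ℚ} (hV : V • W = W'.quadraticTwist (-1))
  {θ : AlgebraicClosure ℚ} (hθ : θ ^ 2 = algebraMap ℚ (AlgebraicClosure ℚ) (-1))
  {N : ℕ} [NeZero N] (f : CuspForm (Gamma0 N) 2) (κ : ZpExtension ℚ 2) (γ : absoluteGaloisGroup ℚ)
  (hsp : (W.quadraticTwist (-1)).HasSplitMultiplicativeReductionAtPrime 2)
  (hκ : κ.IsCyclotomic) (hγ : κ.IsTopGenerator γ) (hγ' : IsCyclotomicVariable 2 γ) (hγθ : γ • θ = θ)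
  (hf : IsNewformOf (W.quadraticTwist (-1)) f) (I : Kato2004.IwasawaH1Data W 2 κ γ)
  -- the model of `Sel(W′/ℚ_∞(θ))` over a number field `F` (intended `ℚ(√−1)`) where `W′` is split multiplicative above `2`
  (F : Type) [Field F] [NumberField F]
  (hF : ∀ v : HeightOneSpectrum (𝓞 F), (2 : 𝓞 F) ∈ v.asIdeal → (W'.baseChange F).HasSplitMultiplicativeReductionAt v)
  (κF : ZpExtension F 2) (γF : absoluteGaloisGroup F) (hκF : κF.IsCyclotomic) (hγF : κF.IsTopGenerator γF)
  (DF : (W'.baseChange F).SelmerDualData κF γF) [(kerStab κ θ).Normal]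
  (ΘS : (W'.baseChange F).selmerInfty κF ≃+ W'.selmerGroupOver 2 (kerStab κ θ))
  (hΘS : ∀ s, ((ΘS ((W'.baseChange F).conjSelmerInfty κF γF s) : W'.selmerGroupOver 2 (kerStab κ θ)) :
      W'.subgroupH1 2 (kerStab κ θ)) = W'.conjH1 2 (kerStab κ θ) γ (ΘS s : W'.selmerGroupOver 2 (kerStab κ θ)))
  -- the `2`-adic `L`-function side: an integral multiple `L̃ = 2^m·L⁻ ≠ 0` of the odd branch
  (Lt : IwasawaAlgebra 2) (m : ℕ)
  (hLt : iwasawaToPowerSeries 2 Lt = PowerSeries.C ((2 : ℚ_[2]) ^ m) * padicLFunctionMinusBranchMult f (1 : ℚ_[2]) 1)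
  (hLt0 : Lt ≠ 0)

include hV hθ hsp hκ hγ hγ' hγθ hf I hF hκF hγF DF hΘS hLt hLt0 in
/-- **(−1)-BLOCK DOOR, key `γ`, ANY image, modulo the model**: `ℓ_𝔮(X(W/ℚ_∞)) ≤ ℓ_𝔮(Λ/(L̃))` at every height-one `𝔮 ∌ 2` for
every key-`γ` dual Selmer datum `D` of the ADDITIVE `W` (`W^{(−1)}` split multiplicative at `2`; `W′` a globally minimal model of
the twist, `V • W = W′^{(−1)}`), from `Kato2004.thm12_4`, Greenberg's Thm. 1.14 ×2 and Thm. 1.5 (PRINT, BY NAME), the ONE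
image-free input, the model identification `ΘS` over `F ∋ √−1`, and `L̃ = 2^m·L⁻ ≠ 0`. Compared with GEN 4's
`…AnyImage_of_decomposition_fe`: `hdec` ↦ `AddKatoTwoQuadLayer.hdec_of_model` (KERNEL mod `ΘS`), `hDF`/`hD'` ↦ Greenberg 1.5 +
`isTorsion_model_iff`, the torsion of `X(W/ℚ_∞)` ↦ the ONE input (`isTorsion_selmerDual_of_oddBranchInputsPrintExactAnyImage_of_doorMultiple`),
`Module.Finite` ↦ `SelmerDualData.module_finite_holds`; compared with t42's `…PrintExact_fe_of_model`: no `hirr`, no `hD₀`, no `hD₀'`.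
[cite: Kato2004Asterisque, Thm. 12.4 (p. 221), Thm. 12.5 (3) and (12.5.1) (p. 222), Thm. 17.4 (1) (p. 273), §17.13 (pp. 279–280)]
[cite: GreenbergLNM1716, Thm. 1.5 (p. 61), Thm. 1.14 (p. 68), §4 (p. 107)] [cite: MazurTateTeitelbaum1986Invent, §I.17] -/
theorem lengthAt_selmerDual_le_of_oddBranchInputsPrintExactAnyImage_fe_of_model (h12 : Kato2004.thm12_4)
    (hPE : KatoOddBranchInputsAtTwoNegOneSplitTwistPrintExactAnyImage) (h114 : Greenberg1999_thm114_charIdeal_iota_invariant)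
    (h114F : Greenberg1999.thm114_charIdeal_iota_invariant_splitMult_baseChange) (h15 : thm15_isTorsion_multiplicative_rat) :
    ∀ (D : W.SelmerDualData κ γ) (𝔮 : PrimeSpectrum (IwasawaAlgebra 2)), 𝔮.asIdeal.height = 1 →
      PowerSeries.C (2 : ℤ_[2]) ∉ 𝔮.asIdeal →
      lengthAt (IwasawaAlgebra 2) D.X 𝔮 ≤ lengthAt (IwasawaAlgebra 2) (IwasawaAlgebra 2 ⧸ Ideal.span {Lt}) 𝔮 := by
  intro D 𝔮 h𝔮 hp𝔮
  haveI : Fact (Nat.Prime 2) := ⟨Nat.prime_two⟩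
  -- the twist side: a key-`γ` datum of `W′`, finitely generated, torsion by Greenberg's Thm. 1.5
  let D₀' : W'.SelmerDualData κ γ := W'.selmerDualData κ hγ
  haveI : Module.Finite (IwasawaAlgebra 2) D₀'.X := D₀'.module_finite_holds hγ
  haveI : Module.Finite (IwasawaAlgebra 2) DF.X := DF.module_finite_holds hγF
  have hmult' : W'.HasMultiplicativeReductionAtPrime 2 :=
    (hasSplitMultiplicativeReductionAtPrime_twistModel W W' (by norm_num) hV 2 hsp).hasMultiplicativeReductionAtPrime
  have hD₀' : D₀'.IsTorsion :=
    isTorsion_selmerDual_twistModel_of_thm15 h15 W W' hmult' (by norm_num) hV f hf κ γ hκ hγ D₀'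
  -- the additive side: torsion from the ONE input
  have hD : D.IsTorsion :=
    isTorsion_selmerDual_of_oddBranchInputsPrintExactAnyImage_of_doorMultiple hPE W f κ γ hsp hκ hγ hγ' hf I D Lt m hLt hLt0
  -- the decomposition through the model
  have hDF : DF.IsTorsion := (AddKatoTwoQuadLayer.isTorsion_model_iff κ W' W hV hθ hγθ ΘS hΘS D₀' D DF).mpr ⟨hD₀', hD⟩
  exact lengthAt_selmerDual_le_of_oddBranchInputsPrintExactAnyImage_of_decomposition_fe h12 hPE h114 h114F W f κ γ hsp hκ hγ
    hγ' hf I D W' hmult' F hF κF γF hκF hγF DF hDF D₀' hD₀'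
    (fun 𝔮' _ hp𝔮' ↦ AddKatoTwoQuadLayer.hdec_of_model κ W' W hV hθ hγθ ΘS hΘS D₀' D DF 𝔮' hp𝔮') Lt m hLt hLt0 𝔮 h𝔮 hp𝔮

include hV hθ hsp hκ hγ hγ' hγθ hf I hF hκF hγF DF hΘS hLt hLt0 in
/-- **(−1)-BLOCK DOOR, key `γ⁻¹` (the PRINT-EXACT currency), ANY image, modulo the model**: `ℓ_𝔮(X′) ≤ ℓ_𝔮(Λ/(L̃))` at every
height-one `𝔮 ∌ 2` for every key-`γ⁻¹` datum `D′` of `W` — the key-`γ` door at `ι𝔮` for the tree's key-`γ` datum, transported by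
`Kato2004.selmerDualData_lengthAt_inv_eq` and the functional equation (`MultOddBranchFE.map_invol_span_eq_of_eq_oddBranchMult_two_of_split`).
[cite: Kato2004Asterisque, Thm. 12.5 (3) and (12.5.1) (p. 222), §17.13 (pp. 279–280)] [cite: GreenbergLNM1716, Thm. 1.14 (p. 68)]
[cite: MazurTateTeitelbaum1986Invent, §I.17] [cite: Greenberg1989, pp. 101–102 (S^ι)] -/
theorem lengthAt_selmerDualContra_le_of_oddBranchInputsPrintExactAnyImage_fe_of_model (h12 : Kato2004.thm12_4)
    (hPE : KatoOddBranchInputsAtTwoNegOneSplitTwistPrintExactAnyImage) (h114 : Greenberg1999_thm114_charIdeal_iota_invariant)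
    (h114F : Greenberg1999.thm114_charIdeal_iota_invariant_splitMult_baseChange) (h15 : thm15_isTorsion_multiplicative_rat) :
    ∀ (D' : W.SelmerDualData κ γ⁻¹) (𝔮 : PrimeSpectrum (IwasawaAlgebra 2)), 𝔮.asIdeal.height = 1 →
      PowerSeries.C (2 : ℤ_[2]) ∉ 𝔮.asIdeal →
      lengthAt (IwasawaAlgebra 2) D'.X 𝔮 ≤ lengthAt (IwasawaAlgebra 2) (IwasawaAlgebra 2 ⧸ Ideal.span {Lt}) 𝔮 := by
  intro D' 𝔮 h𝔮 hp𝔮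
  haveI : Fact (Nat.Prime 2) := ⟨Nat.prime_two⟩
  set 𝔮' := PrimeSpectrum.comap (invol 2).toRingHom 𝔮 with h𝔮'def
  have h𝔮' : 𝔮'.asIdeal.height = 1 := by rw [h𝔮'def, Kato2004.height_comap_invol]; exact h𝔮
  have hp𝔮' : PowerSeries.C (2 : ℤ_[2]) ∉ 𝔮'.asIdeal := by
    intro h
    apply hp𝔮
    rw [h𝔮'def, PrimeSpectrum.comap_asIdeal, Ideal.mem_comap] at h
    change invol 2 (PowerSeries.C (2 : ℤ_[2])) ∈ 𝔮.asIdeal at h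
    rwa [invol_C] at h
  have hA := lengthAt_selmerDual_le_of_oddBranchInputsPrintExactAnyImage_fe_of_model W W' hV hθ f κ γ hsp hκ hγ hγ' hγθ hf I
    F hF κF γF hκF hγF DF ΘS hΘS Lt m hLt hLt0 h12 hPE h114 h114F h15 (W.selmerDualData κ hγ) 𝔮' h𝔮' hp𝔮'
  rw [Kato2004.selmerDualData_lengthAt_inv_eq (W.selmerDualData κ hγ) D' 𝔮,
    Kato2004.lengthAt_quotient_span_eq_comap_invol_of_map_invol_span_eq
      (MultOddBranchFE.map_invol_span_eq_of_eq_oddBranchMult_two_of_split hsp hf hLt) 𝔮]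
  exact hA

include hV hθ hsp hκ hγ hγ' hγθ hf I hF hκF hγF DF hΘS hLt hLt0 in
/-- **(−1)-BLOCK MEMBER DOOR, ANY image, modulo the model**: `ℓ_𝔮(X(W₁/ℚ_∞)) ≤ ℓ_𝔮(Λ/(L̃))` at every height-one `𝔮 ∌ 2` for
EVERY `W₁ ∼_ℚ W` (Kato's member `W_K` of the reducible block included) and every key-`γ` datum `D₁` of `W₁` — the door at `W`
transported along the pseudo-isogeny pair (`lengthAt_selmerDual_eq_of_isIsogenous`, lattice-free R14 (b)).
[cite: Kato2004Asterisque, §8.3 (p. 181), Thm. 12.5 (3) and (12.5.1) (p. 222), §17.13 (pp. 279–280)]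
[cite: GreenbergVatsal2000, §2 (p. 28)] [cite: GreenbergLNM1716, Thm. 1.14 (p. 68)] -/
theorem lengthAt_selmerDual_le_of_oddBranchInputsPrintExactAnyImage_fe_of_model_of_isIsogenous (h12 : Kato2004.thm12_4)
    (hPE : KatoOddBranchInputsAtTwoNegOneSplitTwistPrintExactAnyImage) (h114 : Greenberg1999_thm114_charIdeal_iota_invariant)
    (h114F : Greenberg1999.thm114_charIdeal_iota_invariant_splitMult_baseChange) (h15 : thm15_isTorsion_multiplicative_rat)
    (W₁ : WeierstrassCurve ℚ) [W₁.IsElliptic] (hiso : IsIsogenous W W₁) (D₁ : W₁.SelmerDualData κ γ)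
    (𝔮 : PrimeSpectrum (IwasawaAlgebra 2)) (h𝔮 : 𝔮.asIdeal.height = 1) (hp𝔮 : PowerSeries.C (2 : ℤ_[2]) ∉ 𝔮.asIdeal) :
    lengthAt (IwasawaAlgebra 2) D₁.X 𝔮 ≤ lengthAt (IwasawaAlgebra 2) (IwasawaAlgebra 2 ⧸ Ideal.span {Lt}) 𝔮 := by
  haveI : Fact (Nat.Prime 2) := ⟨Nat.prime_two⟩
  have hp𝔮' : PowerSeries.C ((2 : ℕ) : ℤ_[2]) ∉ 𝔮.asIdeal := by exact_mod_cast hp𝔮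
  rw [← lengthAt_selmerDual_eq_of_isIsogenous hiso (W.selmerDualData κ hγ) D₁ 𝔮 hp𝔮']
  exact lengthAt_selmerDual_le_of_oddBranchInputsPrintExactAnyImage_fe_of_model W W' hV hθ f κ γ hsp hκ hγ hγ' hγθ hf I F hF
    κF γF hκF hγF DF ΘS hΘS Lt m hLt hLt0 h12 hPE h114 h114F h15 (W.selmerDualData κ hγ) 𝔮 h𝔮 hp𝔮

end NegOne

/-! ### The (−1)-block doors with the model identification SUPPLIED (t42 GEN 24's `exists_selmerInfty_model`) -/

section NegOneField

variable (W : WeierstrassCurve ℚ) [W.IsElliptic] [W.IsGloballyMinimal] [ContinuousSMul ℤ_[2] (W.tateModule 2)]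
  (W' : WeierstrassCurve ℚ) [W'.IsElliptic] [W'.IsGloballyMinimal] {V : VariableChange ℚ} (hV : V • W = W'.quadraticTwist (-1))
  {θ : AlgebraicClosure ℚ} (hθ : θ ^ 2 = algebraMap ℚ (AlgebraicClosure ℚ) (-1))
  {N : ℕ} [NeZero N] (f : CuspForm (Gamma0 N) 2) (κ : ZpExtension ℚ 2) (γ : absoluteGaloisGroup ℚ)
  (hsp : (W.quadraticTwist (-1)).HasSplitMultiplicativeReductionAtPrime 2)
  (hκ : κ.IsCyclotomic) (hγ : κ.IsTopGenerator γ) (hγ' : IsCyclotomicVariable 2 γ) (hγθ : γ • θ = θ)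
  (hf : IsNewformOf (W.quadraticTwist (-1)) f) (I : Kato2004.IwasawaH1Data W 2 κ γ)
  (Lt : IwasawaAlgebra 2) (m : ℕ)
  (hLt : iwasawaToPowerSeries 2 Lt = PowerSeries.C ((2 : ℚ_[2]) ^ m) * padicLFunctionMinusBranchMult f (1 : ℚ_[2]) 1)
  (hLt0 : Lt ≠ 0)

include hV hθ hsp hκ hγ hγ' hγθ hf I hLt hLt0 in
/-- **(−1)-BLOCK DOOR, key `γ`, ANY image, NO model binder**: `ℓ_𝔮(X(W/ℚ_∞)) ≤ ℓ_𝔮(Λ/(L̃))` at every height-one `𝔮 ∌ 2` for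
every key-`γ` datum `D` of the ADDITIVE `W`, displayed binders = {`Kato2004.thm12_4`, Greenberg Thm. 1.14 ×2, Greenberg Thm. 1.5}
(PRINT, BY NAME) + the ONE image-free input + {`W′` a globally minimal model of the twist, multiplicative at `2`, split
multiplicative above `2` over a quadratic field `F ∋ √−1`} + `L̃ = 2^m·L⁻ ≠ 0` — the model identification is SUPPLIED by t42 GEN
24's `AddKatoTwoQuadLayerModel.exists_selmerInfty_model` (p703782), the torsion binders by §1 of `…PrintExactAnyImageTorsion`.
Compared with t42's `lengthAt_selmerDual_le_of_oddBranchInputsPrintExact_fe_of_quadraticField`: no `hirr`, no `D₀'`/`hD₀'`, no `hD₀`.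
[cite: Kato2004Asterisque, Thm. 12.4 (p. 221), Thm. 12.5 (3) and (12.5.1) (p. 222), Thm. 17.4 (1) (p. 273), §17.13 (pp. 279–280)]
[cite: GreenbergLNM1716, Thm. 1.5 (p. 61), Thm. 1.14 (p. 68), §4 (p. 107)] [cite: MazurTateTeitelbaum1986Invent, §I.17] -/
theorem lengthAt_selmerDual_le_of_oddBranchInputsPrintExactAnyImage_fe_of_quadraticField (h12 : Kato2004.thm12_4)
    (hPE : KatoOddBranchInputsAtTwoNegOneSplitTwistPrintExactAnyImage) (h114 : Greenberg1999_thm114_charIdeal_iota_invariant)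
    (h114F : Greenberg1999.thm114_charIdeal_iota_invariant_splitMult_baseChange) (h15 : thm15_isTorsion_multiplicative_rat)
    (FQ : Type) [Field FQ] [NumberField FQ] {θF : FQ} (hθF : θF ^ 2 = -1) (hF2 : Module.finrank ℚ FQ = 2)
    (hFQ : ∀ v : HeightOneSpectrum (𝓞 FQ), (2 : 𝓞 FQ) ∈ v.asIdeal → (W'.baseChange FQ).HasSplitMultiplicativeReductionAt v) :
    ∀ (D : W.SelmerDualData κ γ) (𝔮 : PrimeSpectrum (IwasawaAlgebra 2)), 𝔮.asIdeal.height = 1 →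
      PowerSeries.C (2 : ℤ_[2]) ∉ 𝔮.asIdeal →
      lengthAt (IwasawaAlgebra 2) D.X 𝔮 ≤ lengthAt (IwasawaAlgebra 2) (IwasawaAlgebra 2 ⧸ Ideal.span {Lt}) 𝔮 := by
  intro D 𝔮 h𝔮 hp𝔮
  haveI : Fact (Nat.Prime 2) := ⟨Nat.prime_two⟩
  haveI : (kerStab κ θ).Normal := normal_kerStab κ hθ
  obtain ⟨κF, γF, hκF, hγF, -, -, ΘS, hΘS⟩ :=
    AddKatoTwoQuadLayerModel.exists_selmerInfty_model κ hκ W' hθ hγ hγθ FQ hθF hF2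
  exact lengthAt_selmerDual_le_of_oddBranchInputsPrintExactAnyImage_fe_of_model W W' hV hθ f κ γ hsp hκ hγ hγ' hγθ hf I FQ
    hFQ κF γF hκF hγF ((W'.baseChange FQ).selmerDualData κF hγF) ΘS hΘS Lt m hLt hLt0 h12 hPE h114 h114F h15 D 𝔮 h𝔮 hp𝔮

include hV hθ hsp hκ hγ hγ' hγθ hf I hLt hLt0 in
/-- **(−1)-BLOCK DOOR, key `γ⁻¹`, ANY image, NO model binder** (the PRINT-EXACT currency).
[cite: Kato2004Asterisque, Thm. 12.5 (3) and (12.5.1) (p. 222), §17.13 (pp. 279–280)] [cite: GreenbergLNM1716, Thm. 1.14 (p. 68)]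
[cite: MazurTateTeitelbaum1986Invent, §I.17] -/
theorem lengthAt_selmerDualContra_le_of_oddBranchInputsPrintExactAnyImage_fe_of_quadraticField (h12 : Kato2004.thm12_4)
    (hPE : KatoOddBranchInputsAtTwoNegOneSplitTwistPrintExactAnyImage) (h114 : Greenberg1999_thm114_charIdeal_iota_invariant)
    (h114F : Greenberg1999.thm114_charIdeal_iota_invariant_splitMult_baseChange) (h15 : thm15_isTorsion_multiplicative_rat)
    (FQ : Type) [Field FQ] [NumberField FQ] {θF : FQ} (hθF : θF ^ 2 = -1) (hF2 : Module.finrank ℚ FQ = 2)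
    (hFQ : ∀ v : HeightOneSpectrum (𝓞 FQ), (2 : 𝓞 FQ) ∈ v.asIdeal → (W'.baseChange FQ).HasSplitMultiplicativeReductionAt v) :
    ∀ (D' : W.SelmerDualData κ γ⁻¹) (𝔮 : PrimeSpectrum (IwasawaAlgebra 2)), 𝔮.asIdeal.height = 1 →
      PowerSeries.C (2 : ℤ_[2]) ∉ 𝔮.asIdeal →
      lengthAt (IwasawaAlgebra 2) D'.X 𝔮 ≤ lengthAt (IwasawaAlgebra 2) (IwasawaAlgebra 2 ⧸ Ideal.span {Lt}) 𝔮 := by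
  intro D' 𝔮 h𝔮 hp𝔮
  haveI : Fact (Nat.Prime 2) := ⟨Nat.prime_two⟩
  haveI : (kerStab κ θ).Normal := normal_kerStab κ hθ
  obtain ⟨κF, γF, hκF, hγF, -, -, ΘS, hΘS⟩ :=
    AddKatoTwoQuadLayerModel.exists_selmerInfty_model κ hκ W' hθ hγ hγθ FQ hθF hF2
  exact lengthAt_selmerDualContra_le_of_oddBranchInputsPrintExactAnyImage_fe_of_model W W' hV hθ f κ γ hsp hκ hγ hγ' hγθ hf
    I FQ hFQ κF γF hκF hγF ((W'.baseChange FQ).selmerDualData κF hγF) ΘS hΘS Lt m hLt hLt0 h12 hPE h114 h114F h15 D' 𝔮 h𝔮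
    hp𝔮

include hV hθ hsp hκ hγ hγ' hγθ hf I hLt hLt0 in
/-- **(−1)-BLOCK MEMBER DOOR, ANY image, NO model binder**: `ℓ_𝔮(X(W₁/ℚ_∞)) ≤ ℓ_𝔮(Λ/(L̃))` at every height-one `𝔮 ∌ 2` for EVERY
`W₁ ∼_ℚ W` (Kato's member `W_K` of the reducible (−1)-split-twist block) — R14 (c)'s socket with T20 (a) AND the model
identification in the kernel. [cite: Kato2004Asterisque, §8.3 (p. 181), Thm. 12.5 (3) and (12.5.1) (p. 222), §17.13 (pp. 279–280)]
[cite: GreenbergVatsal2000, §2 (p. 28)] [cite: GreenbergLNM1716, Thm. 1.14 (p. 68)] -/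
theorem lengthAt_selmerDual_le_of_oddBranchInputsPrintExactAnyImage_fe_of_quadraticField_of_isIsogenous (h12 : Kato2004.thm12_4)
    (hPE : KatoOddBranchInputsAtTwoNegOneSplitTwistPrintExactAnyImage) (h114 : Greenberg1999_thm114_charIdeal_iota_invariant)
    (h114F : Greenberg1999.thm114_charIdeal_iota_invariant_splitMult_baseChange) (h15 : thm15_isTorsion_multiplicative_rat)
    (FQ : Type) [Field FQ] [NumberField FQ] {θF : FQ} (hθF : θF ^ 2 = -1) (hF2 : Module.finrank ℚ FQ = 2)
    (hFQ : ∀ v : HeightOneSpectrum (𝓞 FQ), (2 : 𝓞 FQ) ∈ v.asIdeal → (W'.baseChange FQ).HasSplitMultiplicativeReductionAt v)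
    (W₁ : WeierstrassCurve ℚ) [W₁.IsElliptic] (hiso : IsIsogenous W W₁) (D₁ : W₁.SelmerDualData κ γ)
    (𝔮 : PrimeSpectrum (IwasawaAlgebra 2)) (h𝔮 : 𝔮.asIdeal.height = 1) (hp𝔮 : PowerSeries.C (2 : ℤ_[2]) ∉ 𝔮.asIdeal) :
    lengthAt (IwasawaAlgebra 2) D₁.X 𝔮 ≤ lengthAt (IwasawaAlgebra 2) (IwasawaAlgebra 2 ⧸ Ideal.span {Lt}) 𝔮 := by
  haveI : Fact (Nat.Prime 2) := ⟨Nat.prime_two⟩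
  have hp𝔮' : PowerSeries.C ((2 : ℕ) : ℤ_[2]) ∉ 𝔮.asIdeal := by exact_mod_cast hp𝔮
  rw [← lengthAt_selmerDual_eq_of_isIsogenous hiso (W.selmerDualData κ hγ) D₁ 𝔮 hp𝔮']
  exact lengthAt_selmerDual_le_of_oddBranchInputsPrintExactAnyImage_fe_of_quadraticField W W' hV hθ f κ γ hsp hκ hγ hγ' hγθ
    hf I Lt m hLt hLt0 h12 hPE h114 h114F h15 FQ hθF hF2 hFQ (W.selmerDualData κ hγ) 𝔮 h𝔮 hp𝔮

end NegOneField

/-! ## §2 The (−2)-block doors modulo the model over `ℚ(√−2)`, keyed by the ONE `(−1)` input (R15 kernel) -/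

/-- `L̃ = 2^m·L⁻₂ ≠ 0` forces `L⁻₂ ≠ 0`. [cite: Kato2004Asterisque, Thm. 16.2 (p. 269)] -/
private theorem minusBranchTwist_ne_zero {N : ℕ} (f : CuspForm (Gamma0 N) 2) {Lt : IwasawaAlgebra 2} {m : ℕ}
    (hLt : iwasawaToPowerSeries 2 Lt =
      PowerSeries.C ((2 : ℚ_[2]) ^ m) * padicLFunctionMinusBranchMultTwist f (1 : ℚ_[2]) 1 (-1))
    (hLt0 : Lt ≠ 0) : padicLFunctionMinusBranchMultTwist f (1 : ℚ_[2]) 1 (-1) ≠ 0 := by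
  haveI : Fact (Nat.Prime 2) := ⟨Nat.prime_two⟩
  intro h0
  apply hLt0
  apply iwasawaToPowerSeries_injective 2
  rw [hLt, h0, mul_zero, map_zero]

section NegTwo

variable (W : WeierstrassCurve ℚ) [W.IsElliptic] [W.IsGloballyMinimal] [ContinuousSMul ℤ_[2] (W.tateModule 2)]
  (W' : WeierstrassCurve ℚ) [W'.IsElliptic] [W'.IsGloballyMinimal] {V : VariableChange ℚ} (hV : V • W = W'.quadraticTwist (-2))
  {θ : AlgebraicClosure ℚ} (hθ : θ ^ 2 = algebraMap ℚ (AlgebraicClosure ℚ) (-2))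
  {N : ℕ} [NeZero N] (f : CuspForm (Gamma0 N) 2) (κ : ZpExtension ℚ 2) (γ : absoluteGaloisGroup ℚ)
  (hsp : (W.quadraticTwist (-2)).HasSplitMultiplicativeReductionAtPrime 2)
  (hκ : κ.IsCyclotomic) (hγ : κ.IsTopGenerator γ) (hγ' : IsCyclotomicVariable 2 γ) (hγθ : γ • θ = θ)
  (hf : IsNewformOf (W.quadraticTwist (-2)) f) (I : Kato2004.IwasawaH1Data W 2 κ γ)
  -- the model of `Sel(W′/ℚ_∞(θ))` over a number field `F` (intended `ℚ(√−2)`) where `W′` is split multiplicative above `2`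
  (F : Type) [Field F] [NumberField F]
  (hF : ∀ v : HeightOneSpectrum (𝓞 F), (2 : 𝓞 F) ∈ v.asIdeal → (W'.baseChange F).HasSplitMultiplicativeReductionAt v)
  (κF : ZpExtension F 2) (γF : absoluteGaloisGroup F) (hκF : κF.IsCyclotomic) (hγF : κF.IsTopGenerator γF)
  (DF : (W'.baseChange F).SelmerDualData κF γF) [(kerStab κ θ).Normal]
  (ΘS : (W'.baseChange F).selmerInfty κF ≃+ W'.selmerGroupOver 2 (kerStab κ θ))
  (hΘS : ∀ s, ((ΘS ((W'.baseChange F).conjSelmerInfty κF γF s) : W'.selmerGroupOver 2 (kerStab κ θ)) :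
      W'.subgroupH1 2 (kerStab κ θ)) = W'.conjH1 2 (kerStab κ θ) γ (ΘS s : W'.selmerGroupOver 2 (kerStab κ θ)))
  -- the `2`-adic `L`-function side: an integral multiple `L̃ = 2^m·L⁻₂ ≠ 0` of the `ω·χ₂`-branch
  (Lt : IwasawaAlgebra 2) (m : ℕ)
  (hLt : iwasawaToPowerSeries 2 Lt =
    PowerSeries.C ((2 : ℚ_[2]) ^ m) * padicLFunctionMinusBranchMultTwist f (1 : ℚ_[2]) 1 (-1))
  (hLt0 : Lt ≠ 0)

include hV hθ hsp hκ hγ hγ' hγθ hf I hF hκF hγF DF hΘS hLt hLt0 in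
/-- **(−2)-BLOCK DOOR, key `γ`, ANY image, modulo the model over `ℚ(√−2)`, keyed by the ONE `(−1)` input**:
`ℓ_𝔮(X(W/ℚ_∞)) ≤ ℓ_𝔮(Λ/(L̃))` at every height-one `𝔮 ∌ 2` for every key-`γ` datum `D` of the ADDITIVE `W` (`W^{(−2)}` split
multiplicative at `2`; `W′` a globally minimal model of the twist by `−2`), from `Kato2004.thm12_4`, Greenberg's Thm. 1.14 ×2 and
Thm. 1.5 (PRINT, BY NAME), `KatoOddBranchInputsAtTwoNegOneSplitTwistPrintExactAnyImage` through R15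
(`AddKatoTwoGammaTwist.katoOddBranchInputsNegTwoPrintExactAnyImage_of_negOne`), the model identification `ΘS` over `F ∋ √−2`
(`AddKatoTwoQuadLayer.hdec_of_model_negTwo`, `isTorsion_model_negTwo`), and `L̃ = 2^m·L⁻₂ ≠ 0`.
[cite: Kato2004Asterisque, Thm. 12.4 (p. 221), Thm. 12.5 (3) and (12.5.1) (p. 222), Thm. 17.4 (1) (p. 273), §17.13 (pp. 279–280)]
[cite: GreenbergLNM1716, Thm. 1.5 (p. 61), Thm. 1.14 (p. 68), §4 (p. 107)] [cite: MazurTateTeitelbaum1986Invent, §I.13, §I.17] -/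
theorem lengthAt_selmerDual_le_of_oddBranchInputsPrintExactAnyImage_negTwo_fe_of_model (h12 : Kato2004.thm12_4)
    (hPE : KatoOddBranchInputsAtTwoNegOneSplitTwistPrintExactAnyImage) (h114 : Greenberg1999_thm114_charIdeal_iota_invariant)
    (h114F : Greenberg1999.thm114_charIdeal_iota_invariant_splitMult_baseChange) (h15 : thm15_isTorsion_multiplicative_rat) :
    ∀ (D : W.SelmerDualData κ γ) (𝔮 : PrimeSpectrum (IwasawaAlgebra 2)), 𝔮.asIdeal.height = 1 →
      PowerSeries.C (2 : ℤ_[2]) ∉ 𝔮.asIdeal →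
      lengthAt (IwasawaAlgebra 2) D.X 𝔮 ≤ lengthAt (IwasawaAlgebra 2) (IwasawaAlgebra 2 ⧸ Ideal.span {Lt}) 𝔮 := by
  intro D 𝔮 h𝔮 hp𝔮
  haveI : Fact (Nat.Prime 2) := ⟨Nat.prime_two⟩
  let D₀' : W'.SelmerDualData κ γ := W'.selmerDualData κ hγ
  haveI : Module.Finite (IwasawaAlgebra 2) D₀'.X := D₀'.module_finite_holds hγ
  haveI : Module.Finite (IwasawaAlgebra 2) DF.X := DF.module_finite_holds hγF
  have hmult' : W'.HasMultiplicativeReductionAtPrime 2 :=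
    (hasSplitMultiplicativeReductionAtPrime_twistModel W W' (by norm_num) hV 2 hsp).hasMultiplicativeReductionAtPrime
  have hD₀' : D₀'.IsTorsion :=
    isTorsion_selmerDual_twistModel_of_thm15 h15 W W' hmult' (by norm_num) hV f hf κ γ hκ hγ D₀'
  have hD : D.IsTorsion :=
    isTorsion_selmerDual_of_oddBranchInputsPrintExactAnyImage_negTwo W f κ γ hsp hκ hγ hγ' hf I hPE D
      (minusBranchTwist_ne_zero f hLt hLt0)
  have hDF : DF.IsTorsion := AddKatoTwoQuadLayer.isTorsion_model_negTwo κ W' W hV hθ hγθ ΘS hΘS D₀' D DF hD₀' hD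
  exact lengthAt_selmerDual_le_of_oddBranchInputsNegTwoPrintExactAnyImage_of_decomposition_fe h12
    (AddKatoTwoGammaTwist.katoOddBranchInputsNegTwoPrintExactAnyImage_of_negOne hPE) h114 h114F W f κ γ hsp hκ hγ hγ' hf I D W'
    hmult' F hF κF γF hκF hγF DF hDF D₀' hD₀' (AddKatoTwoQuadLayer.hdec_of_model_negTwo κ W' W hV hθ hγθ ΘS hΘS D₀' D DF) Lt m
    hLt hLt0 𝔮 h𝔮 hp𝔮

include hV hθ hsp hκ hγ hγ' hγθ hf I hF hκF hγF DF hΘS hLt hLt0 in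
/-- **(−2)-BLOCK DOOR, key `γ⁻¹`, ANY image, modulo the model** — the key-`γ` door at `ι𝔮` transported by
`Kato2004.selmerDualData_lengthAt_inv_eq` and the functional equation of the `ω·χ₂`-branch
(`MultOddBranchFE.map_invol_span_eq_of_eq_oddBranchMultTwist_two_of_split`).
[cite: Kato2004Asterisque, Thm. 12.5 (3) and (12.5.1) (p. 222), §17.13 (pp. 279–280)] [cite: MazurTateTeitelbaum1986Invent, §I.17]
[cite: Greenberg1989, pp. 101–102 (S^ι)] -/
theorem lengthAt_selmerDualContra_le_of_oddBranchInputsPrintExactAnyImage_negTwo_fe_of_model (h12 : Kato2004.thm12_4)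
    (hPE : KatoOddBranchInputsAtTwoNegOneSplitTwistPrintExactAnyImage) (h114 : Greenberg1999_thm114_charIdeal_iota_invariant)
    (h114F : Greenberg1999.thm114_charIdeal_iota_invariant_splitMult_baseChange) (h15 : thm15_isTorsion_multiplicative_rat) :
    ∀ (D' : W.SelmerDualData κ γ⁻¹) (𝔮 : PrimeSpectrum (IwasawaAlgebra 2)), 𝔮.asIdeal.height = 1 →
      PowerSeries.C (2 : ℤ_[2]) ∉ 𝔮.asIdeal →
      lengthAt (IwasawaAlgebra 2) D'.X 𝔮 ≤ lengthAt (IwasawaAlgebra 2) (IwasawaAlgebra 2 ⧸ Ideal.span {Lt}) 𝔮 := by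
  intro D' 𝔮 h𝔮 hp𝔮
  haveI : Fact (Nat.Prime 2) := ⟨Nat.prime_two⟩
  set 𝔮' := PrimeSpectrum.comap (invol 2).toRingHom 𝔮 with h𝔮'def
  have h𝔮' : 𝔮'.asIdeal.height = 1 := by rw [h𝔮'def, Kato2004.height_comap_invol]; exact h𝔮
  have hp𝔮' : PowerSeries.C (2 : ℤ_[2]) ∉ 𝔮'.asIdeal := by
    intro h
    apply hp𝔮
    rw [h𝔮'def, PrimeSpectrum.comap_asIdeal, Ideal.mem_comap] at h
    change invol 2 (PowerSeries.C (2 : ℤ_[2])) ∈ 𝔮.asIdeal at h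
    rwa [invol_C] at h
  have hA := lengthAt_selmerDual_le_of_oddBranchInputsPrintExactAnyImage_negTwo_fe_of_model W W' hV hθ f κ γ hsp hκ hγ hγ'
    hγθ hf I F hF κF γF hκF hγF DF ΘS hΘS Lt m hLt hLt0 h12 hPE h114 h114F h15 (W.selmerDualData κ hγ) 𝔮' h𝔮' hp𝔮'
  rw [Kato2004.selmerDualData_lengthAt_inv_eq (W.selmerDualData κ hγ) D' 𝔮,
    Kato2004.lengthAt_quotient_span_eq_comap_invol_of_map_invol_span_eq
      (MultOddBranchFE.map_invol_span_eq_of_eq_oddBranchMultTwist_two_of_split hsp hf hLt) 𝔮]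
  exact hA

include hV hθ hsp hκ hγ hγ' hγθ hf I hF hκF hγF DF hΘS hLt hLt0 in
/-- **(−2)-BLOCK MEMBER DOOR, ANY image, modulo the model**: `ℓ_𝔮(X(W₁/ℚ_∞)) ≤ ℓ_𝔮(Λ/(L̃))` at every height-one `𝔮 ∌ 2` for
EVERY `W₁ ∼_ℚ W` and every key-`γ` datum `D₁` of `W₁`. [cite: Kato2004Asterisque, §8.3 (p. 181), Thm. 12.5 (3) and (12.5.1) (p. 222), §17.13 (pp. 279–280)]
[cite: GreenbergVatsal2000, §2 (p. 28)] [cite: GreenbergLNM1716, Thm. 1.14 (p. 68)] -/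
theorem lengthAt_selmerDual_le_of_oddBranchInputsPrintExactAnyImage_negTwo_fe_of_model_of_isIsogenous (h12 : Kato2004.thm12_4)
    (hPE : KatoOddBranchInputsAtTwoNegOneSplitTwistPrintExactAnyImage) (h114 : Greenberg1999_thm114_charIdeal_iota_invariant)
    (h114F : Greenberg1999.thm114_charIdeal_iota_invariant_splitMult_baseChange) (h15 : thm15_isTorsion_multiplicative_rat)
    (W₁ : WeierstrassCurve ℚ) [W₁.IsElliptic] (hiso : IsIsogenous W W₁) (D₁ : W₁.SelmerDualData κ γ)
    (𝔮 : PrimeSpectrum (IwasawaAlgebra 2)) (h𝔮 : 𝔮.asIdeal.height = 1) (hp𝔮 : PowerSeries.C (2 : ℤ_[2]) ∉ 𝔮.asIdeal) :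
    lengthAt (IwasawaAlgebra 2) D₁.X 𝔮 ≤ lengthAt (IwasawaAlgebra 2) (IwasawaAlgebra 2 ⧸ Ideal.span {Lt}) 𝔮 := by
  haveI : Fact (Nat.Prime 2) := ⟨Nat.prime_two⟩
  have hp𝔮' : PowerSeries.C ((2 : ℕ) : ℤ_[2]) ∉ 𝔮.asIdeal := by exact_mod_cast hp𝔮
  rw [← lengthAt_selmerDual_eq_of_isIsogenous hiso (W.selmerDualData κ hγ) D₁ 𝔮 hp𝔮']
  exact lengthAt_selmerDual_le_of_oddBranchInputsPrintExactAnyImage_negTwo_fe_of_model W W' hV hθ f κ γ hsp hκ hγ hγ' hγθ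
    hf I F hF κF γF hκF hγF DF ΘS hΘS Lt m hLt hLt0 h12 hPE h114 h114F h15 (W.selmerDualData κ hγ) 𝔮 h𝔮 hp𝔮

end NegTwo

end Summit.BirchSwinnertonDyer.BirchSwinnertonDyer.Theorems.AddKatoTwo

end
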